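import Summits.HodgeConjecture.HodgeConjecture.Theorems.P2StubGHolGermOfWeak
import HarnessLib

/-!
# Crux `HLiu418`, K-lane sub-line `F0_P5TP2SpectralProjection` — stub **(G₂)** `stub_G₂ : StubG₂ProbeCROfWeak`:
# POINTWISE Cauchy–Riemann along the `𝔭`-probe from the WEAK (`L²`) one (one coordinate)

Cell hodgecm-mathlib (D-0151), FLOOR 0, programme P5 (Alb-CM), crux item `HLiu418` = stmt-HodgeConjecture-24832; K-lane sub-line
`Cruxes/HLiu418/Lines/F0_P5TP2SpectralProjection.lean` (skeleton v0 by A-p14 (g16), sha16 ce659ab5fe57535c, HOME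
`A-provers/A-p14/g16/TP2/`; registration by A-plan1 (g18) pending), registered-to-be stub **(G₂) `stub_G₂ : StubG₂ProbeCROfWeak`** (§2 there,
size M−; «any free hand» on the card — A-p04 (g21) bid 2026-08-31T01:54:26Z).  THEOREMS ONLY (no definition, no instance, no notation, no named
fact, no `sorry`); `--supports stmt-HodgeConjecture-24832 --as helper`.  HC_CM is proved only modulo the 7 printed citations until rung 0
closes; this file proves nothing about them.

THE STATEMENT, with the Lines-local bundles `Realises₁` ∕ `IsWeaklyHol₁` ∕ `probeP₁` ∕ `orbitP₁` UNFOLDED into their fields (a `Theorems/` file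
cannot import a `Cruxes/…/Lines/` module, s347 ∕ s380 (b)) and stated for ANY adelic group datum `𝒢`, ANY section `ιinf : S →* G(𝔸_K)` of a
group `S` and ANY probe family `γ : ℂ → S` (the sub-line instantiates at `𝒢 = G2 L H = U(H)`, `S = U(σ_{w₁}H)(ℂ)`, `ιinf = sec₁ L ι H =
adelicSingle w₁`, `γ z = exp (X z)`): if `Ψ : G(𝔸_K) → ℂ` is left-`A_G·G(K)`-invariant, its `𝔭`-probes `z ↦ Ψ (y · ιinf (γ z))` have
derivatives at `0` that are CONTINUOUS in the base point `y` and REPRESENT (on the quotient, a.e.) the `L²`-derivatives of the `𝔭`-orbit map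
`z ↦ R(ιinf (γ z)) w` of a class `w`, and `w` is WEAKLY holomorphic (its `L²` orbit differential at `0` is `ℂ`-linear), then every probe
differential is `ℂ`-linear: `∂Ψ(y)(I z) = I ∂Ψ(y)(z)` for ALL `y`, `z`.  Proof = the rank-3 (G) argument of ★ `P2StubGHolGermOfWeak` (F0P2-p01
(g2), p797242) at one coordinate: the Cauchy–Riemann defect `y ↦ ∂Ψ(y)(I z) − I ∂Ψ(y)(z)` is continuous and left-invariant, its descent
represents `D(I z) − I D(z) = 0`, hence it vanishes a.e. on the quotient, hence identically because an automorphic measure charges every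
non-empty open set (★ `P2StubGHolGermOfWeak.eq_zero_of_toQuotFun_ae_eq_zero`, reused BY IMPORT).  Neither continuity of `Ψ` itself
(`Realises₁.cont`), nor `Realises₁.aeEq`, nor differentiability of the probes (`Realises₁.diff`) is needed; they are carried as underscored
binders by the second, fold-shaped theorem only.  [Borel1997, §5.14]; [BorelWallach2000, VII 2.10].

* `probeCR_of_weaklyHol` — the honest generic form (four hypotheses).
* `stubG₂_holds` — the fold-shaped form: hypotheses = the six fields of `Realises₁ 𝒢 μ ιinf γ Ψ w` IN DECLARATION ORDER (`leftInv`, `cont`,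
  `aeEq`, `diff`, `contDeriv`, `derivAe`, with `probeP₁` ∕ `orbitP₁` unfolded) followed by `IsWeaklyHol₁ 𝒢 μ ιinf γ w` unfolded; the registrar's
  fold of the Lines stub is the one-liner
  `theorem stub_G₂ : StubG₂ProbeCROfWeak := fun L _ _ _ ι H γ μ _ w Ψ hR hW =>
     F0P5TP2StubG.stubG₂_holds (G2 L H) μ (sec₁ L ι H) γ w Ψ hR.leftInv hR.cont hR.aeEq hR.diff hR.contDeriv hR.derivAe hW`.

## References
* [Borel1997] A. Borel, *Automorphic forms on SL₂(ℝ)*, Cambridge Tracts in Math. 130 (1997), §5.14 (holomorphy read on the group), Thm. 2.13.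
* [BorelWallach2000] A. Borel, N. Wallach, *Continuous cohomology, discrete subgroups, and representations of reductive groups*, 2nd ed.
  (2000), VII 2.10.
* [BorelJacquet1979] A. Borel, H. Jacquet, *Automorphic forms and automorphic representations*, PSPM 33.1 (1979), §4.2, §4.6.
-/

set_option autoImplicit false

-- the mandated namespace has the single-problem summit's repeated segment (`HodgeConjecture.HodgeConjecture`)
set_option linter.dupNamespace false

noncomputable section

namespace Summit.HodgeConjecture.HodgeConjecture.Cruxes.HLiu418.F0P5TP2StubG

open MeasureTheory NumberField
open Literature.NumberTheory.Automorphic Literature.NumberTheory.Automorphic.UnitaryGroup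
open Literature.NumberTheory.Automorphic.UnitaryGroup.CotangentForms (toQuotFun)
open Summit.HodgeConjecture.HodgeConjecture.Cruxes.H413.P2StubGHolGermOfWeak (eq_zero_of_toQuotFun_ae_eq_zero)

variable {K : Type} [Field K] [NumberField K] (𝒢 : AdelicGroupData.{0} K)
  (μ : Measure 𝒢.automorphicQuotient) [𝒢.IsAutomorphicMeasure μ]
  {S : Type} [Group S] (ιinf : S →* 𝒢.Adelic) (γ : ℂ → S)

/-- **(G₂), honest form — POINTWISE CAUCHY–RIEMANN ALONG THE PROBE FROM THE WEAK ONE.**  For a left-`A_G·G(K)`-invariant `Ψ` whose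
`𝔭`-probe derivatives `y ↦ ∂(z ↦ Ψ (y · ιinf (γ z)))(0)` are continuous in `y` and represent a.e. the `L²`-derivatives of the orbit map
`z ↦ R(ιinf (γ z)) w` of a weakly holomorphic class `w`, the probe differential at every base point is `ℂ`-linear.  The CR defect is a
continuous left-invariant function whose descent vanishes a.e.; an automorphic measure charges opens. [cite: Borel1997, §5.14]
[cite: BorelWallach2000, VII 2.10] -/
theorem probeCR_of_weaklyHol (w : 𝒢.L2 μ) (Ψ : 𝒢.Adelic → ℂ)
    (hleft : ∀ γr ∈ 𝒢.quotientSubgroup, ∀ x, Ψ (γr * x) = Ψ x)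
    (hcontD : ∀ z : ℂ, Continuous fun y => fderiv ℝ (fun z : ℂ => Ψ (y * ιinf (γ z))) 0 z)
    (hderivAe : ∀ z : ℂ,
      toQuotFun 𝒢 (fun y => fderiv ℝ (fun z : ℂ => Ψ (y * ιinf (γ z))) 0 z) =ᵐ[μ]
        ((fderiv ℝ (fun z : ℂ => 𝒢.rightRegular μ (ιinf (γ z)) w) 0 z : 𝒢.L2 μ) : 𝒢.automorphicQuotient → ℂ))
    (hweak : ∀ z : ℂ,
      fderiv ℝ (fun z : ℂ => 𝒢.rightRegular μ (ιinf (γ z)) w) 0 (Complex.I • z) =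
        Complex.I • fderiv ℝ (fun z : ℂ => 𝒢.rightRegular μ (ιinf (γ z)) w) 0 z)
    (y : 𝒢.Adelic) (z : ℂ) :
    fderiv ℝ (fun z : ℂ => Ψ (y * ιinf (γ z))) 0 (Complex.I • z) =
      Complex.I • fderiv ℝ (fun z : ℂ => Ψ (y * ιinf (γ z))) 0 z := by
  -- the CR defect of `Ψ` in direction `z`, as a function of the base point
  set E : 𝒢.Adelic → ℂ := fun y =>
    fderiv ℝ (fun z : ℂ => Ψ (y * ιinf (γ z))) 0 (Complex.I • z) -
      Complex.I • fderiv ℝ (fun z : ℂ => Ψ (y * ιinf (γ z))) 0 z with hE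
  have hEleft : ∀ γr ∈ 𝒢.quotientSubgroup, ∀ x, E (γr * x) = E x := by
    intro γr hγr x
    have hfun : (fun z : ℂ => Ψ (γr * x * ιinf (γ z))) = fun z => Ψ (x * ιinf (γ z)) := by
      funext z; rw [mul_assoc, hleft γr hγr]
    simp only [hE, hfun]
  have hEcont : Continuous E := (hcontD (Complex.I • z)).sub ((hcontD z).const_smul Complex.I)
  have hEae : toQuotFun 𝒢 E =ᵐ[μ] 0 := by
    have h1 := hderivAe (Complex.I • z)
    have h2 := hderivAe z
    have h3 := Lp.coeFn_smul Complex.I (fderiv ℝ (fun z : ℂ => 𝒢.rightRegular μ (ιinf (γ z)) w) 0 z : 𝒢.L2 μ)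
    rw [← hweak z] at h3
    filter_upwards [h1, h2, h3] with q hq1 hq2 hq3
    -- `toQuotFun` is evaluation at a representative, hence commutes with the pointwise operations
    have hq : toQuotFun 𝒢 E q = toQuotFun 𝒢 (fun y => fderiv ℝ (fun z : ℂ => Ψ (y * ιinf (γ z))) 0 (Complex.I • z)) q -
        Complex.I • toQuotFun 𝒢 (fun y => fderiv ℝ (fun z : ℂ => Ψ (y * ιinf (γ z))) 0 z) q := rfl
    rw [hq, hq1, hq2, hq3, Pi.smul_apply, sub_self, Pi.zero_apply]
  have hE0 : E = 0 := eq_zero_of_toQuotFun_ae_eq_zero 𝒢 μ hEleft hEcont hEae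
  have := congrFun hE0 y
  simp only [hE, Pi.zero_apply, sub_eq_zero] at this
  exact this

/-- **(G₂), fold-shaped form — the stub `stub_G₂ : StubG₂ProbeCROfWeak` of `Lines/F0_P5TP2SpectralProjection.lean` with its bundles unfolded**:
hypotheses are the six fields of `Realises₁ 𝒢 μ ιinf γ Ψ w` in declaration order (`leftInv`, `cont`, `aeEq`, `diff`, `contDeriv`, `derivAe`;
only the first and the last two are used) and `IsWeaklyHol₁ 𝒢 μ ιinf γ w`; conclusion = pointwise Cauchy–Riemann of every `𝔭`-probe
`probeP₁ 𝒢 ιinf γ Ψ y = fun z => Ψ (y * ιinf (γ z))`.  Fold: `fun L _ _ _ ι H γ μ _ w Ψ hR hW => stubG₂_holds (G2 L H) μ (sec₁ L ι H) γ w Ψ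
hR.leftInv hR.cont hR.aeEq hR.diff hR.contDeriv hR.derivAe hW`. [cite: Borel1997, §5.14] [cite: BorelWallach2000, VII 2.10] -/
theorem stubG₂_holds (w : 𝒢.L2 μ) (Ψ : 𝒢.Adelic → ℂ)
    (hleft : ∀ γr ∈ 𝒢.quotientSubgroup, ∀ x, Ψ (γr * x) = Ψ x)
    (_hcont : Continuous Ψ)
    (_haeEq : toQuotFun 𝒢 Ψ =ᵐ[μ] (w : 𝒢.automorphicQuotient → ℂ))
    (_hdiff : ∀ y, DifferentiableAt ℝ (fun z : ℂ => Ψ (y * ιinf (γ z))) 0)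
    (hcontD : ∀ z : ℂ, Continuous fun y => fderiv ℝ (fun z : ℂ => Ψ (y * ιinf (γ z))) 0 z)
    (hderivAe : ∀ z : ℂ,
      toQuotFun 𝒢 (fun y => fderiv ℝ (fun z : ℂ => Ψ (y * ιinf (γ z))) 0 z) =ᵐ[μ]
        ((fderiv ℝ (fun z : ℂ => 𝒢.rightRegular μ (ιinf (γ z)) w) 0 z : 𝒢.L2 μ) : 𝒢.automorphicQuotient → ℂ))
    (hweak : ∀ z : ℂ,
      fderiv ℝ (fun z : ℂ => 𝒢.rightRegular μ (ιinf (γ z)) w) 0 (Complex.I • z) =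
        Complex.I • fderiv ℝ (fun z : ℂ => 𝒢.rightRegular μ (ιinf (γ z)) w) 0 z) :
    ∀ (y : 𝒢.Adelic) (z : ℂ),
      fderiv ℝ (fun z : ℂ => Ψ (y * ιinf (γ z))) 0 (Complex.I • z) =
        Complex.I • fderiv ℝ (fun z : ℂ => Ψ (y * ιinf (γ z))) 0 z :=
  probeCR_of_weaklyHol 𝒢 μ ιinf γ w Ψ hleft hcontD hderivAe hweak

end Summit.HodgeConjecture.HodgeConjecture.Cruxes.HLiu418.F0P5TP2StubG

end
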